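import Mathlib
import Literature.Computability.AlgebraicComplexity.CollisionIdeal
import Summits.ValiantsHypothesis.ValiantsHypothesis.Theses.ForgivenCollisions

/-!
# Route `ForgivenCollisions` — support item `CoeffAgreement` (stmt-ValiantsHypothesis-11573)

The DICTIONARY of the route: for every `r n` and every `P ∈ ℂ[x_{ij}]_{i,j<n}`,
`P − per_n ∈ J_r(n)` iff `P` and `per_n` have the same coefficient at every exponent `d` that is
not `Bad_r` (a tripled line, or at least `r` doubly occupied lines).

The route states `J_r(n)` and `Bad_r` inline; they are *by `rfl`* the Literature notions
`Literature.Computability.AlgebraicComplexity.collisionIdeal ℂ r n`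
(`collisionIdeal_def`) and `Literature.Computability.AlgebraicComplexity.IsCollisionBad r d`
(`isCollisionBad_iff`) of `Literature/Computability/AlgebraicComplexity/CollisionIdeal.lean`, where
the dictionary is the theorem `sub_mem_collisionIdeal_iff` (Mathlib's monomial-ideal criterion
`MvPolynomial.mem_ideal_span_monomial_image` plus the fact that `Bad_r` is an upper set,
`IsCollisionBad.mono`). So the item is that theorem, transported along the definitional unfolding.
-/

-- `Summit.ValiantsHypothesis.ValiantsHypothesis.…` is the tree's mandated single-conjunct layout
-- (Sub = Summit), so the duplicated namespace component is intended.
set_option linter.dupNamespace false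

namespace Summit.ValiantsHypothesis.ValiantsHypothesis.Theorems.ForgivenCollisions

open Literature.Computability.AlgebraicComplexity
open Summit.ValiantsHypothesis.ValiantsHypothesis.Theses.ForgivenCollisions

/-- The route's inlined statement, phrased over the Literature names: for every `r n P`,
`P - per_n ∈ collisionIdeal ℂ r n ↔ ∀ d, ¬ IsCollisionBad r d → coeff d P = coeff d per_n`.
This is `sub_mem_collisionIdeal_iff` with `Q := perPoly (Fin n) ℂ`. [folklore] -/
theorem sub_perPoly_mem_collisionIdeal_iff (r n : ℕ) (P : MvPolynomial (Fin n × Fin n) ℂ) :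
    P - perPoly (Fin n) ℂ ∈ collisionIdeal ℂ r n ↔
      ∀ d, ¬ IsCollisionBad r d →
        MvPolynomial.coeff d P = MvPolynomial.coeff d (perPoly (Fin n) ℂ) :=
  sub_mem_collisionIdeal_iff

/-- **Item `CoeffAgreement`** (stmt-ValiantsHypothesis-11573) of route `ForgivenCollisions`:
`P − per_n ∈ J_r(n)` iff `P` and `per_n` agree at every exponent that is not `Bad_r`. The route's
inline `Ideal.span ((fun d => monomial d 1) '' {d | …})` and inline `Bad_r` disjunction are
definitionally `collisionIdeal ℂ r n` and `IsCollisionBad r d` (`collisionIdeal_def`,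
`isCollisionBad_iff`), so this is `sub_perPoly_mem_collisionIdeal_iff` verbatim. [folklore] -/
theorem coeffAgreement_proof : CoeffAgreement := by
  intro r n P
  exact sub_perPoly_mem_collisionIdeal_iff r n P

end Summit.ValiantsHypothesis.ValiantsHypothesis.Theorems.ForgivenCollisions
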